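import Summits.QuantumFields.YangMills.Theorems.FemtoCutoffLadderWalledTopPairSF
import Summits.QuantumFields.YangMills.Theorems.FemtoTransferGapMultiplierIMS
import HarnessLib

/-!
# The DOOB (ground-state) identity for WALLED ground states (brick 6 of the walled spectral package — route `FemtoCutoffLadder`,
# crux `LocalWallStep` stmt-QuantumFields-26282, cancellation route)

Seat `leafhand-qf-femtocutoffladder-2` g0 (2026-08-30), `--supports stmt-QuantumFields-26282`.  The tree's product identity ✓`energy_mul_eq_su2`
(`FemtoTransferGapMultiplierIMS`) holds for ANY physical `η`; for a walled ground state `Ω` (hard wall off the good set, WEAK eigen-relation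
`⟨f, K_βΩ⟩ = t⟨f, Ω⟩` for every walled physical `f` — ✓`exists_walledTopPair`, brick 5a) the correction term `t⟨g²Ω,Ω⟩ − ⟨g²Ω, K_βΩ⟩` VANISHES
because `g²Ω` is itself walled.  Hence:
* ★ `doob_of_weak_walled_eigen`: `t‖gΩ‖² − ⟨gΩ, K_β(gΩ)⟩ = ½ ∫∫ Ω(U)K_β(U,V)Ω(V)(g(U) − g(V))²` for every bounded measurable gauge- and
  twist-invariant multiplier `g` — the walled Rayleigh deficit of a multiplier state IS the `ΩK_βΩ`-weighted Dirichlet form;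
* ★ `exists_walledGround_doob`: for every SF wall set `Q` (`β > 0`, real `κ`) a physical walled `l2`-normalised `Ω₀` with the pointwise wall
  eigen-equation at `t Q` AND the Doob identity at `t Q` for all multipliers.
So `1 − s_Q/t_Q` is the gap of the weighted Dirichlet form over multipliers `g` with `gΩ₀ ⊥ Ω₀` (given walled Jentzsch: `Ω₀ > 0` on the good set,
so that every walled state is a multiplier state — the next brick), and the crux `LocalWallStep` becomes the ONE-MORE-WALL comparison of two such
Dirichlet gaps (the XL content: zero-mode imprint, uniform in `Q`).
HONEST FRAMING: fixed-lattice identities; no estimate; R2b1 RECORD rung — not infinite volume, not a mass gap, not Clay; no summit is proved by this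
file.  No definitions, no named facts, no `sorry`.  [cite: SimonB1983DiscreteSpectrum, §3] [cite: ReedSimonIV1978, Thm. XIII.1]
-/

set_option autoImplicit false

noncomputable section

open MeasureTheory Filter Topology Real
open Literature.MathematicalPhysics.QuantumFieldTheory
open Literature.MathematicalPhysics.QuantumLattice
open Literature.Analysis.OperatorTheory
open scoped InnerProductSpace

namespace Summit.QuantumFields.YangMills.Theorems.FemtoTransferGap.PhysL2

open Summit.QuantumFields.YangMills.Theorems.FemtoTransferGap

variable {L : ℕ} [NeZero L]

/-- ★ **Doob identity from a WEAK walled eigen-relation.**  `Ω` physical vanishing on the bad event `B`, with `⟨f, K_βΩ⟩ = t⟨f,Ω⟩` for every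
physical `f` vanishing on `B`; `g` a bounded measurable gauge- and twist-invariant multiplier.  Then
`t‖gΩ‖² − ⟨gΩ, K_β(gΩ)⟩ = ½ ∫∫ Ω(U) K_β(U,V) Ω(V) (g(U) − g(V))²`. [cite: SimonB1983DiscreteSpectrum, §3] -/
theorem doob_of_weak_walled_eigen (β : ℝ) {B : GaugeConfig 3 L SU2 → Prop} {Ω : GaugeConfig 3 L SU2 → ℝ} (hΩ : IsPhys Ω)
    (hΩB : ∀ U, B U → Ω U = 0) {t : ℝ}
    (hweak : ∀ f : GaugeConfig 3 L SU2 → ℝ, IsPhys f → (∀ U, B U → f U = 0) → qform su2Rep β f Ω = t * l2 f Ω)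
    {g : GaugeConfig 3 L SU2 → ℝ} (hgm : Measurable g) {Cg : ℝ} (hgb : ∀ U, |g U| ≤ Cg)
    (hgg : ∀ (k : Site 3 L → SU2) (U : GaugeConfig 3 L SU2), g (gaugeTransform k U) = g U)
    (hgz : ∀ (k : Fin 3), ∀ z ∈ Subgroup.center SU2, ∀ U : GaugeConfig 3 L SU2, g (twist k z U) = g U) :
    t * l2 (fun U => g U * Ω U) (fun U => g U * Ω U) - qform su2Rep β (fun U => g U * Ω U) (fun U => g U * Ω U) =
      (1 / 2) * ∫ p, Ω p.1 * transferKernel su2Rep β p.1 p.2 * Ω p.2 * (g p.1 - g p.2) ^ 2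
        ∂(configMeasure SU2 L).prod (configMeasure SU2 L) := by
  rw [energy_mul_eq_su2 β hgm hgb hgg hgz hΩ t]
  have hf : IsPhys (fun U => g U ^ 2 * Ω U) := hΩ.sq_mul_of_invariant hgm hgb hgg hgz
  have hfB : ∀ U, B U → g U ^ 2 * Ω U = 0 := fun U hU => by rw [hΩB U hU, mul_zero]
  have h := hweak _ hf hfB
  rw [qform_eq_l2_transferApply] at h
  rw [h]
  ring

/-- ★ **Walled ground state with its Doob identity, for every SF wall set.**  `β > 0`, real `κ`, `Q ⊆ Plaquette 3 L`: there is a physical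
`l2`-normalised `Ω₀` vanishing wherever a plaquette of `Q` is κ-bad, with the pointwise wall eigen-equation `1_{good} · K_βΩ₀ = t Q · Ω₀`,
the weak form, and the Doob identity at `t Q` for every bounded measurable invariant multiplier. [cite: SimonB1983DiscreteSpectrum, §3]
[cite: ReedSimonIV1978, Thm. XIII.1] -/
theorem exists_walledGround_doob {β : ℝ} (hβ : 0 < β) (κ : ℝ) (Q : Set (Plaquette 3 L)) :
    ∃ Ω₀ : GaugeConfig 3 L SU2 → ℝ, IsPhys Ω₀ ∧
      (∀ U, (∃ p ∈ Q, β ^ (κ - 1) < 2 - (su2Rep (plaquetteHolonomy U p.1 p.2.1.1 p.2.1.2)).trace.re) → Ω₀ U = 0) ∧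
      l2 Ω₀ Ω₀ = 1 ∧
      (∀ U, {U : GaugeConfig 3 L SU2 | ¬ ∃ p ∈ Q, β ^ (κ - 1) <
          2 - (su2Rep (plaquetteHolonomy U p.1 p.2.1.1 p.2.1.2)).trace.re}.indicator (transferApply β Ω₀) U =
        sSup (rayleighSet su2Rep L β fun ψ => ∀ U : GaugeConfig 3 L SU2,
          (∃ p ∈ Q, β ^ (κ - 1) < 2 - (su2Rep (plaquetteHolonomy U p.1 p.2.1.1 p.2.1.2)).trace.re) → ψ U = 0) * Ω₀ U) ∧
      (∀ {g : GaugeConfig 3 L SU2 → ℝ}, Measurable g → ∀ {Cg : ℝ}, (∀ U, |g U| ≤ Cg) →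
        (∀ (k : Site 3 L → SU2) (U : GaugeConfig 3 L SU2), g (gaugeTransform k U) = g U) →
        (∀ (k : Fin 3), ∀ z ∈ Subgroup.center SU2, ∀ U : GaugeConfig 3 L SU2, g (twist k z U) = g U) →
        sSup (rayleighSet su2Rep L β fun ψ => ∀ U : GaugeConfig 3 L SU2,
            (∃ p ∈ Q, β ^ (κ - 1) < 2 - (su2Rep (plaquetteHolonomy U p.1 p.2.1.1 p.2.1.2)).trace.re) → ψ U = 0) *
            l2 (fun U => g U * Ω₀ U) (fun U => g U * Ω₀ U) - qform su2Rep β (fun U => g U * Ω₀ U) (fun U => g U * Ω₀ U) =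
          (1 / 2) * ∫ p, Ω₀ p.1 * transferKernel su2Rep β p.1 p.2 * Ω₀ p.2 * (g p.1 - g p.2) ^ 2
            ∂(configMeasure SU2 L).prod (configMeasure SU2 L)) := by
  obtain ⟨Ω₀, Ω₁, hΩ₀, -, hΩ₀S, -, hn₀, -, -, heig₀, -, hweak⟩ := exists_walledTopPair hβ κ Q
  refine ⟨Ω₀, hΩ₀, hΩ₀S, hn₀, heig₀, fun hgm Cg hgb hgg hgz => ?_⟩
  exact doob_of_weak_walled_eigen β hΩ₀ hΩ₀S (fun f hf hfS => (hweak f hf hfS).1) hgm hgb hgg hgz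

end Summit.QuantumFields.YangMills.Theorems.FemtoTransferGap.PhysL2

end
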